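import Summits.HodgeConjecture.HodgeConjecture.Theorems.F0P2oD7alphaMemDockOfRowsT       -- ★ p840515 (F0P2-p01 (g9)): producerᵀ `stubD7αMemDockPerMeasureT_of_rows 𝔇 h hrecT`
import Summits.HodgeConjecture.HodgeConjecture.Theorems.F0P2oD7alphaShapeOfRecordSCD      -- ★ p840662 (F0P2-p01 (g9)): `shape_xiPacketFamilyOfRecordSCD_of_packageTest` (SHAPE at the SCD record)
import HarnessLib

/-!
# Crux `H413`, programme P2 — (D7α) «D7αᵀ AT RUNG 0, DRY TERM»: the node `StubD7αMemDockPerMeasureT` AT THE ROWS OF A KIT FAMILY OF RECORD WHOSE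
# ξ-PACKETS ARE THE SCD RECORD — SHAPE discharged (★ p840662); the closer supplies `keys`, `hQT`, the K-side identification, Haar ×2, H₇, (D-b)ᵀ

Cell `hodgecm-mathlib` (D-0151), FLOOR 0, crux item H413 = `stmt-HodgeConjecture-24833`, route of record `HCCMUnconditional`; programme P2, fallback road PKΠ
`Cruxes/H413/Lines/F0_P2PKPiRung4.lean` v1.15 «DOCK-T» (commit 8815f50bd152; node `stub_D7αMemDockμT : StubD7αMemDockPerMeasureT`).  Desk F0P2-plan (g9)
PLAN-P2 v9.1 §3 ∕ §4 brief P2-B1 (2026-09-01T04:00Z); F0P2-p01 (g9).  Helper file: THEOREMS ONLY (no definition, no named fact, no instance, no notation,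
no `sorry`); `--supports stmt-HodgeConjecture-24833 --as helper`.  HONEST LABEL: HC_CM is proved only modulo the printed citations until rung 0 closes;
this file discharges none of them — its hypotheses are the closer's fourteen ROWS and, per (frame, μ), the rung-0 exports named below; it is
instantiated only where the rung-0 choice is in scope (the closer's §D, F0P3 desk ∕ LEAD F0P3a pens).

WHAT.  ★ producerᵀ `stubD7αMemDockPerMeasureT_of_rows 𝔇 h hrecT` takes, per (frame, μ), record data `(Δ, mH, mG, νG, νH, μZ)` with FIVE clauses
(H₄ᵀ) SHAPE ∧ (H₅) Haar `μZ` ∧ (H₆) Haar `νG` ∧ (H₇) local Δ-transfer existence at non-split `v` ∧ (H₈ᵀ) the print letter (D-b)ᵀ.  After R4-SC ED. 2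
(DATA) (★ A1ᴰ p840594 ∕ A2ᴰ p840635 ∕ B1ᴰ p840651) the closer's ξ-packets are the SCD record `xiPacketFamilyOfRecordSCD … μZ keys (hSCD_of_cmCharIdentityPackageTest … hQT)`,
whose SHAPE is ★ p840662 — so (H₄ᵀ)–(H₆) are replaced here by the closer's ACTUAL exports (Haar ×2 become binders `hHaar`, `_hνG` so that (Ξ) can be stated):
  (K) `keys` (the Keys handle), (Qᵀ) `hQT : CMCharIdentityPackageTest L H hH hHd νH νG μω hμu Δ mH mG` (the re-typed Q-CM letter, ★ p840183 shape), and
  (Ξ) `(kitFamilyOfRecord 𝔇 …).packFin = xiPacketFamilyOfRecordSCD … μZ keys (hSCD_of_cmCharIdentityPackageTest … hQT)` (K-side identification; at rung 0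
  `(kitFamilyOfRecord 𝔇₀ …).packFin = (𝔇₀ …).ξd.packFin` is `rfl` and `𝔇₀.ξd = xiSideOfRecordSCD …` (★ B1ᴰ), so (Ξ) is `rfl` ∕ ★ `xiSideOfRecordSCD_packFin`),
with `hH := transpose_map_cmConjRingHom_eq_of_frame L ι H T hT`, `hHd := isUnit_det_of_frame L ι H T hT` (the frame's own witnesses, as in the node's MEM clause).

* `stubD7αMemDockPerMeasureT_of_rowsSCD 𝔇 h hrecSCD : StubD7αMemDockPerMeasureT` — ★ producerᵀ fed (H₄ᵀ) := ★ `shape_xiPacketFamilyOfRecordSCD_of_packageTest`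
  transported along (Ξ); (H₅)–(H₈ᵀ) passed through.  The closer's term: `stubD7αMemDockPerMeasureT_of_rowsSCD frameDataOfRung0 rows_of_rung0
  (fun L ι H T hT hdef h2 μω hμu hμω μ _ => ⟨Δ, mH, mG, νG, νH, μZ, isHaar_μZ, isHaar_νG, keys, hQT, rfl ∕ packFin-lemma, hex, fun e₁ dV hdV hdV0 g hg ξ => stub_DbT …⟩)`.

References: [Rogawski1990] §12.2 (2) pp. 173–174; §13.1 Prop. 13.1.3 (d), Prop. 13.1.4 p. 199; §13.3 pp. 201–202; §4.9 Prop. 4.9.1 (a).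
[GelbartRogawski1991] Lem. 5.1.2 p. 466; Thm. 5.1.1 p. 465.
-/

set_option autoImplicit false
-- the mandated namespace repeats `HodgeConjecture.HodgeConjecture`, as in every `Theorems/*.lean` of this sub-problem
set_option linter.dupNamespace false

noncomputable section

open NumberField IsDedekindDomain MeasureTheory
open scoped Matrix ComplexOrder

namespace Summit.HodgeConjecture.HodgeConjecture.Cruxes.H413.F0P2oD7alphaMemDockOfRowsSCD

open Literature.NumberTheory.Rogawski1990 Literature.NumberTheory.GaloisRepresentations
open Literature.NumberTheory.Automorphic Literature.NumberTheory.Automorphic.UnitaryGroup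
open Literature.NumberTheory.Automorphic.UnitaryGroup.CotangentForms
open Literature.RepresentationTheory.BorelWallach2000 Literature.RepresentationTheory.KonnoKonno2007
open Summit.HodgeConjecture.HodgeConjecture.Cruxes.H413.F0P3InnerFormClassificationV6 (Gp Places)
open Summit.HodgeConjecture.HodgeConjecture.Cruxes.H413.F0P3KitOfRecord (FrameData kitFamilyOfRecord)
open Summit.HodgeConjecture.HodgeConjecture.Cruxes.H413.F0P3XiArchPacketOfRecord (JInfNoDegOne DsInfNoDegOne)

/-! ## The node at the rows of a kit family of record whose ξ-packets are the SCD record -/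

section PerMeasureSCD

variable
  (𝔇 : ∀ (L : Type) [Field L] [NumberField L] [IsCMField L] (ι : L →+* ℂ) (H : Matrix (Fin 3) (Fin 3) L) (T : GL (Fin 3) ℂ)
    (hT : (T : Matrix (Fin 3) (Fin 3) ℂ)ᴴ * H.map ι * (T : Matrix (Fin 3) (Fin 3) ℂ) = Literature.Geometry.ComplexHyperbolic.BallModel.J),
    (∀ τ' : L →+* ℂ, InfinitePlace.mk τ' ≠ InfinitePlace.mk ι → (H.map τ').PosDef) →
    2 ≤ Module.finrank ℚ ↥(maximalRealSubfield L) →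
    ∀ (μ : Measure (Gp L H).automorphicQuotient) [(Gp L H).IsAutomorphicMeasure μ] (μω : HeckeCharacter L) (_hμu : μω.IsUnitary),
    (∀ x : Literature.NumberTheory.GaloisRepresentations.ideleGroup ↥(maximalRealSubfield L),
      μω (AdeleRing.ideleBaseChange (↥(maximalRealSubfield L)) L x) = quadraticHeckeCharCM L x) → FrameData L H ι T hT μ)
  (h : ∀ (L : Type) [Field L] [NumberField L] [IsCMField L] (ι : L →+* ℂ) (H : Matrix (Fin 3) (Fin 3) L) (T : GL (Fin 3) ℂ)
    (hT : (T : Matrix (Fin 3) (Fin 3) ℂ)ᴴ * H.map ι * (T : Matrix (Fin 3) (Fin 3) ℂ) = Literature.Geometry.ComplexHyperbolic.BallModel.J)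
    (hdef : ∀ τ' : L →+* ℂ, InfinitePlace.mk τ' ≠ InfinitePlace.mk ι → (H.map τ').PosDef) (h2 : 2 ≤ Module.finrank ℚ ↥(maximalRealSubfield L))
    (μ : Measure (Gp L H).automorphicQuotient) [(Gp L H).IsAutomorphicMeasure μ] (μω : HeckeCharacter L) (hμu : μω.IsUnitary)
    (hμω : ∀ x : Literature.NumberTheory.GaloisRepresentations.ideleGroup ↥(maximalRealSubfield L),
      μω (AdeleRing.ideleBaseChange (↥(maximalRealSubfield L)) L x) = quadraticHeckeCharCM L x),
    ∃ S₀ : Finset (Places L),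
    F0P3InnerFormClassificationV8.ClassificationKit.SpecPkg (kitFamilyOfRecord 𝔇 L ι H T hT hdef h2 μ μω hμu hμω) S₀ ∧
    (kitFamilyOfRecord 𝔇 L ι H T hT hdef h2 μ μω hμu hμω).TraceIdentity ∧
    F0P3InnerFormClassificationV8.ClassificationKit.FactorisationCls (kitFamilyOfRecord 𝔇 L ι H T hT hdef h2 μ μω hμu hμω) S₀ ∧
    (kitFamilyOfRecord 𝔇 L ι H T hT hdef h2 μ μω hμu hμω).SpectralSideGp ∧
    F0P3InnerFormClassificationV8.ClassificationKit.HatBounded (kitFamilyOfRecord 𝔇 L ι H T hT hdef h2 μ μω hμu hμω) S₀ ∧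
    F0P3InnerFormClassificationV8.ClassificationKit.UnrStarAlgebra (kitFamilyOfRecord 𝔇 L ι H T hT hdef h2 μ μω hμu hμω) S₀ ∧
    (kitFamilyOfRecord 𝔇 L ι H T hT hdef h2 μ μω hμu hμω).LinIndepS ∧
    F0P3InnerFormClassificationV8.ClassificationKit.UnitaryPacket (kitFamilyOfRecord 𝔇 L ι H T hT hdef h2 μ μω hμu hμω) S₀ ∧
    (kitFamilyOfRecord 𝔇 L ι H T hT hdef h2 μ μω hμu hμω).Routing ∧
    JInfNoDegOne (𝔇 L ι H T hT hdef h2 μ μω hμu hμω).jInf ∧ DsInfNoDegOne (𝔇 L ι H T hT hdef h2 μ μω hμu hμω).dsInf ∧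
    (kitFamilyOfRecord 𝔇 L ι H T hT hdef h2 μ μω hμu hμω).XiFamilyFin μω hμu ∧
    (kitFamilyOfRecord 𝔇 L ι H T hT hdef h2 μ μω hμu hμω).XiUnram ∧
    (kitFamilyOfRecord 𝔇 L ι H T hT hdef h2 μ μω hμu hμω).EvpConvention)

include h in
/-- **(D7α) «D7αᵀ AT RUNG 0, DRY TERM»: PKΠ's node `StubD7αMemDockPerMeasureT` AT THE ROWS OF A KIT FAMILY OF RECORD WHOSE ξ-PACKETS ARE THE SCD
RECORD.**  Per (frame, μ) the closer supplies `(Δ, mH, mG, νG, νH, μZ)`, the Keys handle `keys`, the Test package `hQT`, the K-side identification (Ξ),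
Haar ×2, (H₇) local Δ-transfer existence at non-split places and (H₈ᵀ) the print letter (D-b)ᵀ; SHAPE is ★ `shape_xiPacketFamilyOfRecordSCD_of_packageTest`
transported along (Ξ), and everything else is ★ producerᵀ `stubD7αMemDockPerMeasureT_of_rows`.
[cite: Rogawski1990, §13.1 Prop. 13.1.3 (d), Prop. 13.1.4 p. 199; §12.2 (2) pp. 173–174] [cite: GelbartRogawski1991, Lem. 5.1.2 p. 466; Thm. 5.1.1 p. 465] -/
theorem stubD7αMemDockPerMeasureT_of_rowsSCD
  (hrecSCD : ∀ (L : Type) [Field L] [NumberField L] [IsCMField L] (ι : L →+* ℂ) (H : Matrix (Fin 3) (Fin 3) L) (T : GL (Fin 3) ℂ)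
    (hT : (T : Matrix (Fin 3) (Fin 3) ℂ)ᴴ * H.map ι * (T : Matrix (Fin 3) (Fin 3) ℂ) = Literature.Geometry.ComplexHyperbolic.BallModel.J)
    (hdef : ∀ τ' : L →+* ℂ, InfinitePlace.mk τ' ≠ InfinitePlace.mk ι → (H.map τ').PosDef) (h2 : 2 ≤ Module.finrank ℚ ↥(maximalRealSubfield L))
    (μω : HeckeCharacter L) (hμu : μω.IsUnitary)
    (hμω : ∀ x : Literature.NumberTheory.GaloisRepresentations.ideleGroup ↥(maximalRealSubfield L), μω (AdeleRing.ideleBaseChange (↥(maximalRealSubfield L)) L x) = quadraticHeckeCharCM L x)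
    (μ : Measure (adelicGroupData (↥(maximalRealSubfield L)) L (IsCMField.complexConj L) 3 H).automorphicQuotient) [(adelicGroupData (↥(maximalRealSubfield L)) L (IsCMField.complexConj L) 3 H).IsAutomorphicMeasure μ],
    letI : ∀ v : HeightOneSpectrum (𝓞 ↥(maximalRealSubfield L)), MeasurableSpace ((cmDatum L 3 H).Local v) := fun _ => borel _
    letI : ∀ v : HeightOneSpectrum (𝓞 ↥(maximalRealSubfield L)),
        MeasurableSpace ((cmDatum L 2 (Matrix.of fun i j : Fin 2 => if i.val + j.val + 1 = 2 then (1 : L) else 0)).Local v ×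
          (cmDatum L 1 (Matrix.of fun i j : Fin 1 => if i.val + j.val + 1 = 1 then (1 : L) else 0)).Local v) := fun _ => borel _
    letI : ∀ (v : HeightOneSpectrum (𝓞 ↥(maximalRealSubfield L)))
        (a : ((cmDatum L 2 (Matrix.of fun i j : Fin 2 => if i.val + j.val + 1 = 2 then (1 : L) else 0)).Local v ×
          (cmDatum L 1 (Matrix.of fun i j : Fin 1 => if i.val + j.val + 1 = 1 then (1 : L) else 0)).Local v)),
        MeasurableSpace (((cmDatum L 2 (Matrix.of fun i j : Fin 2 => if i.val + j.val + 1 = 2 then (1 : L) else 0)).Local v ×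
            (cmDatum L 1 (Matrix.of fun i j : Fin 1 => if i.val + j.val + 1 = 1 then (1 : L) else 0)).Local v) ⧸
          Subgroup.centralizer ({a} : Set ((cmDatum L 2 (Matrix.of fun i j : Fin 2 => if i.val + j.val + 1 = 2 then (1 : L) else 0)).Local v ×
            (cmDatum L 1 (Matrix.of fun i j : Fin 1 => if i.val + j.val + 1 = 1 then (1 : L) else 0)).Local v))) := fun _ _ => borel _
    letI : ∀ (v : HeightOneSpectrum (𝓞 ↥(maximalRealSubfield L))) (γ : (cmDatum L 3 H).Local v),
        MeasurableSpace ((cmDatum L 3 H).Local v ⧸ Subgroup.centralizer ({γ} : Set ((cmDatum L 3 H).Local v))) := fun _ _ => borel _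
    letI : ∀ v : HeightOneSpectrum (𝓞 ↥(maximalRealSubfield L)), MeasurableSpace (Gqs L v ⧸ Subgroup.center (Gqs L v)) := fun _ => borel _
    ∃ (Δ : ∀ v : HeightOneSpectrum (𝓞 ↥(maximalRealSubfield L)), LocalTransferFactor L H v)
      (mH : ∀ v : HeightOneSpectrum (𝓞 ↥(maximalRealSubfield L)),
    OrbitalMeasureFamily ((cmDatum L 2 (Matrix.of fun i j : Fin 2 => if i.val + j.val + 1 = 2 then (1 : L) else 0)).Local v ×
      (cmDatum L 1 (Matrix.of fun i j : Fin 1 => if i.val + j.val + 1 = 1 then (1 : L) else 0)).Local v))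
      (mG : ∀ v : HeightOneSpectrum (𝓞 ↥(maximalRealSubfield L)), OrbitalMeasureFamily ((cmDatum L 3 H).Local v))
      (νG : ∀ v : HeightOneSpectrum (𝓞 ↥(maximalRealSubfield L)), Measure ((cmDatum L 3 H).Local v))
      (νH : ∀ v : HeightOneSpectrum (𝓞 ↥(maximalRealSubfield L)),
    Measure ((cmDatum L 2 (Matrix.of fun i j : Fin 2 => if i.val + j.val + 1 = 2 then (1 : L) else 0)).Local v ×
      (cmDatum L 1 (Matrix.of fun i j : Fin 1 => if i.val + j.val + 1 = 1 then (1 : L) else 0)).Local v))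
      (μZ : ∀ v : HeightOneSpectrum (𝓞 ↥(maximalRealSubfield L)), Measure (Gqs L v ⧸ Subgroup.center (Gqs L v))),
      -- (K) THE KEYS HANDLE and (Qᵀ) THE TEST PACKAGE at these data (the closer's rung-0 exports `keys`, `hQT`), and
      -- (Ξ) the K-side identification: the kit family's finite ξ-packets ARE the SCD record at the datum read off `hQT` (at rung 0: ★ B1ᴰ `xiSideOfRecordSCD`, `rfl`)
      ∃ (hHaar : ∀ v : HeightOneSpectrum (𝓞 ↥(maximalRealSubfield L)), (μZ v).IsHaarMeasure)
        (_hνG : ∀ v : HeightOneSpectrum (𝓞 ↥(maximalRealSubfield L)), (νG v).IsHaarMeasure)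
        (keys : ∀ (ξ : OneDimAutRepH L) (v : HeightOneSpectrum (𝓞 ↥(maximalRealSubfield L))),
        (∀ w : PlacesOver L v, IsCMField.complexConj L • w.1 = w.1) →
          {p : IrrClass (Gqs L v) × IrrClass (Gqs L v) //
            KeysCaseTwoLabels L v (μω.semilocalComponent L v) (torusLocalComponent L (IsCMField.complexConj L) v ξ.η)
              (torusLocalComponent L (IsCMField.complexConj L) v ξ.ψ) p.1 p.2 ∧
            p.1.IsSquareIntegrable (μZ v) ∧ ¬ p.2.IsSquareIntegrable (μZ v)})
      (hQT : CMCharIdentityPackageTest L H (transpose_map_cmConjRingHom_eq_of_frame L ι H T hT) (isUnit_det_of_frame L ι H T hT) νH νG μω hμu Δ mH mG),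
      (haveI : ∀ v : HeightOneSpectrum (𝓞 ↥(maximalRealSubfield L)), (μZ v).IsHaarMeasure := hHaar
       haveI : ∀ v : HeightOneSpectrum (𝓞 ↥(maximalRealSubfield L)), BorelSpace (Gqs L v ⧸ Subgroup.center (Gqs L v)) := fun _ => ⟨rfl⟩
       (kitFamilyOfRecord 𝔇 L ι H T hT hdef h2 μ μω hμu hμω).packFin =
        F0P3XiPacketFamilyOfRecordSCD.xiPacketFamilyOfRecordSCD L H (transpose_map_cmConjRingHom_eq_of_frame L ι H T hT) (isUnit_det_of_frame L ι H T hT)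
          μω hμu μZ keys
          (F0P3XiPacketFamilyOfRecordSCD.hSCD_of_cmCharIdentityPackageTest L H (transpose_map_cmConjRingHom_eq_of_frame L ι H T hT)
            (isUnit_det_of_frame L ι H T hT) μω hμu Δ mH mG νG νH μZ hQT)) ∧
      -- (H₇) `φ ↦ φ^H` exists on `C_c^∞` at every non-split finite place [Rogawski1990 Prop. 4.9.1 (a)] (the N6 #102 currency)
      (∀ v : HeightOneSpectrum (𝓞 ↥(maximalRealSubfield L)), (∀ w : PlacesOver L v, IsCMField.complexConj L • w.1 = w.1) →
        IsLocalDeltaTransferExists L H v (Δ v) (mH v) (mG v) Literature.NumberTheory.Rogawski1990.IsLocSmooth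
          Literature.NumberTheory.Rogawski1990.IsLocSmooth) ∧
      -- (H₈ᵀ) the print letter (D-b)ᵀ ON TEST FUNCTIONS, BY NAME, at these data [GelbartRogawski1991 Lem. 5.1.2, Thm. 5.1.1; Rogawski1992 Thm. 1.1]
      (∀ {n' : ℕ} (e₁ : Fin 3 × Fin 1 ≃ Fin n') (dV : Fin 3 → L) (hdV : ∀ i, IsCMField.complexConj L (dV i) = dV i) (hdV0 : ∀ i, dV i ≠ 0) (g : GL (Fin 3) L)
          (hg : ((g : Matrix (Fin 3) (Fin 3) L).map (cmConjRingHom L))ᵀ * H * (g : Matrix (Fin 3) (Fin 3) L) = Matrix.diagonal dV) (ξ : OneDimAutRepH L),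
        Literature.NumberTheory.GelbartRogawski1991.piSCompletion_isThetaTypeAtCMTest L H Δ mH mG νH νG ξ μω (fun v => ξ.xiLocalChar v) e₁ dV hdV hdV0 g hg)) :
    F0P2oD7alphaMemDockStatement.StubD7αMemDockPerMeasureT := by
  refine F0P2oD7alphaMemDockOfRowsT.stubD7αMemDockPerMeasureT_of_rows 𝔇 h ?_
  intro L _ _ _ ι H T hT hdef h2 μω hμu hμω μ _
  obtain ⟨Δ, mH, mG, νG, νH, μZ, hHaar, hνG, keys, hQT, hpk, hex, hW⟩ := hrecSCD L ι H T hT hdef h2 μω hμu hμω μ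
  refine ⟨Δ, mH, mG, νG, νH, μZ, ?_, hHaar, hνG, hex, hW⟩
  -- SHAPE at the SCD record (★ p840662), transported along the K-side identification (Ξ); borel σ-algebras as in the node's `letI`s
  intro ξ v hns
  letI : ∀ v : HeightOneSpectrum (𝓞 ↥(maximalRealSubfield L)), MeasurableSpace ((cmDatum L 3 H).Local v) := fun _ => borel _
  letI : ∀ v : HeightOneSpectrum (𝓞 ↥(maximalRealSubfield L)),
      MeasurableSpace ((cmDatum L 2 (Matrix.of fun i j : Fin 2 => if i.val + j.val + 1 = 2 then (1 : L) else 0)).Local v ×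
        (cmDatum L 1 (Matrix.of fun i j : Fin 1 => if i.val + j.val + 1 = 1 then (1 : L) else 0)).Local v) := fun _ => borel _
  letI : ∀ (v : HeightOneSpectrum (𝓞 ↥(maximalRealSubfield L)))
      (a : ((cmDatum L 2 (Matrix.of fun i j : Fin 2 => if i.val + j.val + 1 = 2 then (1 : L) else 0)).Local v ×
        (cmDatum L 1 (Matrix.of fun i j : Fin 1 => if i.val + j.val + 1 = 1 then (1 : L) else 0)).Local v)),
      MeasurableSpace (((cmDatum L 2 (Matrix.of fun i j : Fin 2 => if i.val + j.val + 1 = 2 then (1 : L) else 0)).Local v ×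
          (cmDatum L 1 (Matrix.of fun i j : Fin 1 => if i.val + j.val + 1 = 1 then (1 : L) else 0)).Local v) ⧸
        Subgroup.centralizer ({a} : Set ((cmDatum L 2 (Matrix.of fun i j : Fin 2 => if i.val + j.val + 1 = 2 then (1 : L) else 0)).Local v ×
          (cmDatum L 1 (Matrix.of fun i j : Fin 1 => if i.val + j.val + 1 = 1 then (1 : L) else 0)).Local v))) := fun _ _ => borel _
  letI : ∀ (v : HeightOneSpectrum (𝓞 ↥(maximalRealSubfield L))) (γ : (cmDatum L 3 H).Local v),
      MeasurableSpace ((cmDatum L 3 H).Local v ⧸ Subgroup.centralizer ({γ} : Set ((cmDatum L 3 H).Local v))) := fun _ _ => borel _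
  letI : ∀ v : HeightOneSpectrum (𝓞 ↥(maximalRealSubfield L)), MeasurableSpace (Gqs L v ⧸ Subgroup.center (Gqs L v)) := fun _ => borel _
  haveI : ∀ v : HeightOneSpectrum (𝓞 ↥(maximalRealSubfield L)), BorelSpace (Gqs L v ⧸ Subgroup.center (Gqs L v)) := fun _ => ⟨rfl⟩
  haveI : ∀ v : HeightOneSpectrum (𝓞 ↥(maximalRealSubfield L)), (μZ v).IsHaarMeasure := hHaar
  obtain ⟨Tv, a, ha, hc, π2, πn, πs, hK, hs2, hn, hsc, hne, hId, hP⟩ :=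
    F0P2oD7alphaShapeOfRecordSCD.shape_xiPacketFamilyOfRecordSCD_of_packageTest L H (transpose_map_cmConjRingHom_eq_of_frame L ι H T hT)
      (isUnit_det_of_frame L ι H T hT) μω hμu Δ mH mG νG νH μZ keys hQT ξ v hns
  exact ⟨Tv, a, ha, hc, π2, πn, πs, hK, hs2, hn, hsc, hne, hId, by rw [hpk]; exact hP⟩

end PerMeasureSCD

end Summit.HodgeConjecture.HodgeConjecture.Cruxes.H413.F0P2oD7alphaMemDockOfRowsSCD

end
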